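/-
Copyright (c) 2026 the pub-hodgecm-mathlib formalisation cell (harness21).  Prover seat hodgecm-mathlib-LH3-p03 (g6): LH3 «Transf» road, letter L3′ forward half,
brick (JH-E) «THE (J)-H ASSEMBLER» (dealer LH3-plan (g4) 2026-09-02T11:47:46Z BY NAME; spec LH3-p01 (g5) `JH-SPEC.v1.md` §2 (JH-E); binder of record LH3-p01 (g5)).
-/
import Literature.NumberTheory.Rogawski1990.ArchBouazizSmoothBoundedGeneral   -- ★ p851279 (LH3-p01 (g5)): `archBzSmoothBounded_stOrbFamH`, `archBouazizSpaceH_stOrbFamH_of_jump`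
import Literature.NumberTheory.Rogawski1990.ArchBouazizJumpPropagation         -- ★ (π) (F0P3a-p02 (g19)): `archBzJump_of_forall_gSemireg`
import HarnessLib

/-!
# (JH-E) THE (J)-H ASSEMBLER: Bouaziz's jump clause `ArchBzJump jcH (stOrbFamH L νH fH)` — and the whole forward half of letter L3′ — for EVERY `fH ∈ C_c^∞(H_∞)`,
# with ONE jump datum `jcH ≠ 0` chosen BEFORE the test function, from the clause at the `G`-semiregular wall points (Bouaziz 1994 §3.2 (I₃), §6.2; Shelstad 1979 Thm. 4.7)

Topic `NumberTheory/Rogawski1990`; namespace `Literature.NumberTheory.Rogawski1990`.  THEOREMS ONLY (no `def`, no instance, no notation, no axiom, no named fact, no `sorry`).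
Cell `pub/hodgecm-mathlib`, crux H413 (`stmt-HodgeConjecture-24833`), line LH3 (closer stub `stub_N9`, DIRECT ROAD `Cruxes/H413/Lines/F0_P3c_StubN9Direct.lean`), letter L3′
`stub_N9bouazizSurjective` (`BouazizSurjectiveStatement`: `∃ jcH, (∀ S w, w ∉ S → jcH S w ≠ 0) ∧ (∀ fH, ArchSmooth₂ L fH → ArchBouazizSpaceH jcH (stOrbFamH L νH fH)) ∧ ‹surjectivity›`),
FORWARD HALF.  Road (J)-H of LH3-p01 (g5)'s `JH-SPEC.v1.md`: (R0) ★ (π) `archBzJump_of_forall_gSemireg (hSB) (h)` reduces the jump clause (I₃) of a family with Bouaziz's (I₁)+(I₂) to the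
`G`-SEMIREGULAR wall points; `hSB := ★ archBzSmoothBounded_stOrbFamH` (p851279, unconditional for general `fH`); the bricks (JH-A)…(JH-D) (two-chart leaves, split-side wall
representation, the pure-normal rank-one jump through `ℓ_ρ`, the words) produce `h` with a constant `J(S, w₀) ≠ 0` depending on the wall ONLY («(R5) `jcH S w₀ = const(w₀)`» — frame
units, `K₀^S ∕ K₀^{S′}`, `C₁ ∕ C₂`), NOT on `fH` and NOT on the wall point.  THIS FILE is the assembler at the end of that road, typed like the (I₃) assembler ★ p851049
`exists_archHcJump_orbFamGExt` of the `G′`-side: ONE socket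

  `hsemi : ∀ S w₀, w₀ ∉ S → ∃ J : ℂ, J ≠ 0 ∧ ∀ fH, ArchSmooth₂ L fH → ‹(π)'s G-semiregular clause for Ψ := stOrbFamH L νH fH with jcH S w₀ := J, VERBATIM›`

(the constant BEFORE the test function), and the heads

* **`exists_archBzJump_stOrbFamH (hsemi) : ∃ jcH, (∀ S w, w ∉ S → jcH S w ≠ 0) ∧ ∀ fH, ArchSmooth₂ L fH → ArchBzJump jcH (stOrbFamH L νH fH)`** — clause (I₃) for every test
  function with ONE datum (`jcH S w₀ :=` the socket's `J` when `w₀ ∉ S`, `:= 1` on the idle labels `w₀ ∈ S`, which `ArchBzJump` never reads);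
* **`exists_archBouazizSpaceH_stOrbFamH (hsemi) : ∃ jcH, (∀ S w, w ∉ S → jcH S w ≠ 0) ∧ ∀ fH, ArchSmooth₂ L fH → ArchBouazizSpaceH jcH (stOrbFamH L νH fH)`** — THE FORWARD HALF OF
  LETTER L3′ for general `fH`, token for token its first two conjuncts (★ `archBouazizSpaceH_stOrbFamH_of_jump` supplies (P), (W), (I₁)+(I₂), (I₄));
* the per-`fH` corollaries `archBzJump_stOrbFamH_of_gSemireg` ∕ `archBouazizSpaceH_stOrbFamH_of_gSemireg` (a given `jcH` and the clause for ONE `fH`), and the GROUP-FREE uniform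
  form `exists_archBzJump_of_forall_gSemireg_uniform` (any indexed set of `ArchBzSmoothBounded` families) from which the heads are read;
* §3, the same in the LEAF FRAME of `BouazizSurjectiveStatement` — ONE Borel σ-algebra on the product `H_∞` (`[MeasurableSpace H_∞] [BorelSpace H_∞] (νH : Measure H_∞)`), no per-place
  σ-algebras in the binders: `archBzSmoothBounded_stOrbFamH_borel` ((I₁)+(I₂), ★ p851279 transported along `Prod.borelSpace`) and **`exists_archBouazizSpaceH_stOrbFamH_borel (hsemi)`**
  (= the leaf statement's conjuncts 1–2 token for token under the socket).

Pure logic over ★ (π) and ★ p851279 (the choice of `jcH` is `Classical.choose` on the socket, wall by wall); no analysis here.  HONEST LABEL: HC_CM is proved only modulo the 7 printed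
citations (2 remaining: hLiu418 = stmt-HodgeConjecture-24832, h413 = stmt-HodgeConjecture-24833) until rung 0 closes; this file is count-neutral (an assembler of the LH3 direct
road; letter L3′ is NOT claimed — its forward half becomes the single socket `hsemi`, its surjective half is the LH10 board's).

## References
* [Bouaziz1994IntegralesOrbitales] A. Bouaziz, *Intégrales orbitales sur les groupes de Lie réductifs*, Ann. Sci. ÉNS (4) 27 (1994) 573–609: §3.2 (I₃) p. 580 («pour toute donnée de
  saut … `lim_{t→0⁺} − lim_{t→0⁻} = i d(s) ∂(r_{Ψ′}(c_α·u)) b_{Ψ′} ψ^{H′}(s)`»), §6.2 p. 591 (stable version, Thm. 6.2.1 (i)).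
* [Shelstad1979] D. Shelstad, *Characters and inner forms of a quasi-split group over ℝ*, Compositio Math. 39 (1979) 11–45: §4 p. 22, Prop. 4.5 p. 26, Thm. 4.7 (IIIb) p. 31.
-/

set_option autoImplicit false

noncomputable section

open MeasureTheory Measure Filter Topology Set Function NumberField NumberField.InfinitePlace Complex
open Literature.NumberTheory.Automorphic Literature.NumberTheory.Automorphic.UnitaryGroup Literature.NumberTheory.Automorphic.ArchCartan
open Literature.NumberTheory.Automorphic.Shelstad1979.StableOrbitalIntegrals
open scoped Classical

namespace Literature.NumberTheory.Rogawski1990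

/-! ## §1 The group-free uniform form: ONE datum for an indexed set of `ArchBzSmoothBounded` families -/

section Uniform

variable {W : Type*} [Fintype W] [DecidableEq W]

/-- **UNIFORM PROPAGATION** (pure logic over ★ (π) `archBzJump_of_forall_gSemireg`): for an indexed set `Ψ a` (`a : A`) of coordinate families with Bouaziz's (I₁)+(I₂), if at every
wall `(S, w₀)`, `w₀ ∉ S`, ONE constant `J ≠ 0` serves the jump relations of EVERY `Ψ a` at the `G`-semiregular wall points (all orders, all adapted words), then ONE jump datum
`jcH`, non-zero at every wall, gives `ArchBzJump jcH (Ψ a)` for every `a`.  (`jcH S w₀ := J(S, w₀)` for `w₀ ∉ S`, `:= 1` on the idle labels `w₀ ∈ S`.)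
[cite: Bouaziz1994IntegralesOrbitales, §3.2 (I₃) p. 580] [cite: Shelstad1979, Prop. 4.5 (p. 26); Thm. 4.7 (IIIb) (p. 31)] -/
theorem exists_archBzJump_of_forall_gSemireg_uniform {A : Type*} (Ψ : A → Finset W → (W → Fin 3 → ℝ) → ℂ) (hSB : ∀ a, ArchBzSmoothBounded (Ψ a))
    (hsemi : ∀ (S : Finset W) (w₀ : W), w₀ ∉ S → ∃ J : ℂ, J ≠ 0 ∧ ∀ a : A, ∀ p : W → Fin 3 → ℝ, p w₀ 0 = p w₀ 2 →
      Circle.exp (p w₀ 1) ≠ Circle.exp (p w₀ 0) →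
      (∀ v, v ∉ S → v ≠ w₀ → Function.Injective fun i : Fin 3 => Circle.exp (p v i)) →
      (∀ v ∈ S, p v 0 ≠ 0) →
      ∀ (n : ℕ) (m : Fin n → W × Fin 3),
        HasOneSidedJump (fun ν : ℝ => bzTwistedDeriv S n (fun j => bzAdaptedVec w₀ (m j)) (Ψ a S) (p + ν • nrm w₀))
          (J * bzCayScalar w₀ m * bzTwistedDeriv (insert w₀ S) n (fun j => bzCayVec (m j)) (Ψ a (insert w₀ S)) (cayPt w₀ p))) :
    ∃ jcH : Finset W → W → ℂ, (∀ (S : Finset W) (w : W), w ∉ S → jcH S w ≠ 0) ∧ ∀ a : A, ArchBzJump jcH (Ψ a) := by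
  refine ⟨fun S w₀ => if h : w₀ ∉ S then Classical.choose (hsemi S w₀ h) else 1, fun S w hw => ?_, fun a => ?_⟩
  · simp only [hw, not_false_eq_true, dif_pos]
    exact (Classical.choose_spec (hsemi S w hw)).1
  · refine archBzJump_of_forall_gSemireg (hSB a) fun S w₀ hw₀ p hp02 hp1 hinj hx n m => ?_
    simp only [hw₀, not_false_eq_true, dif_pos]
    exact (Classical.choose_spec (hsemi S w₀ hw₀)).2 a p hp02 hp1 hinj hx n m

end Uniform

/-! ## §2 The heads: the stable orbital family of every test function on `H_∞ = ∏_w U(Φ₂)_w × U(Φ₁)_w` -/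

section StOrbFamH

variable (L : Type) [Field L] [NumberField L] [IsCMField L]
  [∀ w : {w : InfinitePlace L // IsComplex w},
    MeasurableSpace ↥(archLocal L 2 (Matrix.of fun i j : Fin 2 => if i.val + j.val + 1 = 2 then (1 : L) else 0) w)]
  [∀ w : {w : InfinitePlace L // IsComplex w},
    BorelSpace ↥(archLocal L 2 (Matrix.of fun i j : Fin 2 => if i.val + j.val + 1 = 2 then (1 : L) else 0) w)]
  [MeasurableSpace ↥(arch (↥(maximalRealSubfield L)) L (IsCMField.complexConj L) 2 (Matrix.of fun i j : Fin 2 => if i.val + j.val + 1 = 2 then (1 : L) else 0))]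
  [BorelSpace ↥(arch (↥(maximalRealSubfield L)) L (IsCMField.complexConj L) 2 (Matrix.of fun i j : Fin 2 => if i.val + j.val + 1 = 2 then (1 : L) else 0))]
  [MeasurableSpace ↥(arch (↥(maximalRealSubfield L)) L (IsCMField.complexConj L) 1 (Matrix.of fun i j : Fin 1 => if i.val + j.val + 1 = 1 then (1 : L) else 0))]
  [BorelSpace ↥(arch (↥(maximalRealSubfield L)) L (IsCMField.complexConj L) 1 (Matrix.of fun i j : Fin 1 => if i.val + j.val + 1 = 1 then (1 : L) else 0))]
  (νH : Measure (↥(arch (↥(maximalRealSubfield L)) L (IsCMField.complexConj L) 2 (Matrix.of fun i j : Fin 2 => if i.val + j.val + 1 = 2 then (1 : L) else 0)) ×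
      ↥(arch (↥(maximalRealSubfield L)) L (IsCMField.complexConj L) 1 (Matrix.of fun i j : Fin 1 => if i.val + j.val + 1 = 1 then (1 : L) else 0))))
  [νH.IsHaarMeasure] [νH.IsMulRightInvariant]

/-- **(J)-H FOR ONE TEST FUNCTION FROM THE `G`-SEMIREGULAR WALL POINTS**: for `fH ∈ C_c^∞(H_∞)` and a jump datum `jcH`, the jump relations of `stOrbFamH L νH fH` at the `G`-semiregular
wall points (★ (π)'s clause verbatim) give `ArchBzJump jcH (stOrbFamH L νH fH)` — (I₁)+(I₂) being ★ `archBzSmoothBounded_stOrbFamH`.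
[cite: Bouaziz1994IntegralesOrbitales, §3.2 (I₃) p. 580; §6.2 p. 591] [cite: Shelstad1979, Prop. 4.5 (p. 26); Thm. 4.7 (IIIb) (p. 31)] -/
theorem archBzJump_stOrbFamH_of_gSemireg
    {fH : ↥(arch (↥(maximalRealSubfield L)) L (IsCMField.complexConj L) 2 (Matrix.of fun i j : Fin 2 => if i.val + j.val + 1 = 2 then (1 : L) else 0)) ×
      ↥(arch (↥(maximalRealSubfield L)) L (IsCMField.complexConj L) 1 (Matrix.of fun i j : Fin 1 => if i.val + j.val + 1 = 1 then (1 : L) else 0)) → ℂ}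
    (hfH : ArchSmooth₂ L fH) {jcH : Finset {w : InfinitePlace L // IsComplex w} → {w : InfinitePlace L // IsComplex w} → ℂ}
    (h : ∀ (S : Finset {w : InfinitePlace L // IsComplex w}) (w₀ : {w : InfinitePlace L // IsComplex w}), w₀ ∉ S →
      ∀ p : {w : InfinitePlace L // IsComplex w} → Fin 3 → ℝ, p w₀ 0 = p w₀ 2 →
      Circle.exp (p w₀ 1) ≠ Circle.exp (p w₀ 0) →
      (∀ v, v ∉ S → v ≠ w₀ → Function.Injective fun i : Fin 3 => Circle.exp (p v i)) →
      (∀ v ∈ S, p v 0 ≠ 0) →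
      ∀ (n : ℕ) (m : Fin n → {w : InfinitePlace L // IsComplex w} × Fin 3),
        HasOneSidedJump (fun ν : ℝ => bzTwistedDeriv S n (fun j => bzAdaptedVec w₀ (m j)) (stOrbFamH L νH fH S) (p + ν • nrm w₀))
          (jcH S w₀ * bzCayScalar w₀ m * bzTwistedDeriv (insert w₀ S) n (fun j => bzCayVec (m j)) (stOrbFamH L νH fH (insert w₀ S)) (cayPt w₀ p))) :
    ArchBzJump jcH (stOrbFamH L νH fH) :=
  archBzJump_of_forall_gSemireg (archBzSmoothBounded_stOrbFamH L νH hfH) h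

/-- **BOUAZIZ-SPACE MEMBERSHIP FOR ONE TEST FUNCTION FROM THE `G`-SEMIREGULAR WALL POINTS**: the previous clause through ★ `archBouazizSpaceH_stOrbFamH_of_jump` ((P), (W), (I₁)+(I₂), (I₄) are ★).
[cite: Bouaziz1994IntegralesOrbitales, §6.2 p. 591, Thm. 6.2.1 (i)] [cite: Shelstad1979, §4 pp. 22–23; Thm. 4.7 (p. 31)] -/
theorem archBouazizSpaceH_stOrbFamH_of_gSemireg
    {fH : ↥(arch (↥(maximalRealSubfield L)) L (IsCMField.complexConj L) 2 (Matrix.of fun i j : Fin 2 => if i.val + j.val + 1 = 2 then (1 : L) else 0)) ×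
      ↥(arch (↥(maximalRealSubfield L)) L (IsCMField.complexConj L) 1 (Matrix.of fun i j : Fin 1 => if i.val + j.val + 1 = 1 then (1 : L) else 0)) → ℂ}
    (hfH : ArchSmooth₂ L fH) {jcH : Finset {w : InfinitePlace L // IsComplex w} → {w : InfinitePlace L // IsComplex w} → ℂ}
    (h : ∀ (S : Finset {w : InfinitePlace L // IsComplex w}) (w₀ : {w : InfinitePlace L // IsComplex w}), w₀ ∉ S →
      ∀ p : {w : InfinitePlace L // IsComplex w} → Fin 3 → ℝ, p w₀ 0 = p w₀ 2 →
      Circle.exp (p w₀ 1) ≠ Circle.exp (p w₀ 0) →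
      (∀ v, v ∉ S → v ≠ w₀ → Function.Injective fun i : Fin 3 => Circle.exp (p v i)) →
      (∀ v ∈ S, p v 0 ≠ 0) →
      ∀ (n : ℕ) (m : Fin n → {w : InfinitePlace L // IsComplex w} × Fin 3),
        HasOneSidedJump (fun ν : ℝ => bzTwistedDeriv S n (fun j => bzAdaptedVec w₀ (m j)) (stOrbFamH L νH fH S) (p + ν • nrm w₀))
          (jcH S w₀ * bzCayScalar w₀ m * bzTwistedDeriv (insert w₀ S) n (fun j => bzCayVec (m j)) (stOrbFamH L νH fH (insert w₀ S)) (cayPt w₀ p))) :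
    ArchBouazizSpaceH jcH (stOrbFamH L νH fH) :=
  archBouazizSpaceH_stOrbFamH_of_jump L νH jcH hfH (archBzJump_stOrbFamH_of_gSemireg L νH hfH h)

/-- **HEAD (i) — (J)-H FOR EVERY TEST FUNCTION WITH ONE JUMP DATUM CHOSEN BEFORE `fH`**: if at every wall `(S, w₀)`, `w₀ ∉ S`, ONE constant `J ≠ 0` serves the jump relations of
`stOrbFamH L νH fH` at the `G`-semiregular wall points for EVERY `fH ∈ C_c^∞(H_∞)` (★ (π)'s clause verbatim with `jcH S w₀ := J`), then there is ONE jump datum `jcH`, non-zero at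
every wall, with `ArchBzJump jcH (stOrbFamH L νH fH)` for every such `fH`. [cite: Bouaziz1994IntegralesOrbitales, §3.2 (I₃) p. 580; §6.2 p. 591]
[cite: Shelstad1979, Prop. 4.5 (p. 26); Thm. 4.7 (IIIb) (p. 31)] -/
theorem exists_archBzJump_stOrbFamH
    (hsemi : ∀ (S : Finset {w : InfinitePlace L // IsComplex w}) (w₀ : {w : InfinitePlace L // IsComplex w}), w₀ ∉ S → ∃ J : ℂ, J ≠ 0 ∧
      ∀ fH : ↥(arch (↥(maximalRealSubfield L)) L (IsCMField.complexConj L) 2 (Matrix.of fun i j : Fin 2 => if i.val + j.val + 1 = 2 then (1 : L) else 0)) ×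
          ↥(arch (↥(maximalRealSubfield L)) L (IsCMField.complexConj L) 1 (Matrix.of fun i j : Fin 1 => if i.val + j.val + 1 = 1 then (1 : L) else 0)) → ℂ,
        ArchSmooth₂ L fH →
        ∀ p : {w : InfinitePlace L // IsComplex w} → Fin 3 → ℝ, p w₀ 0 = p w₀ 2 →
        Circle.exp (p w₀ 1) ≠ Circle.exp (p w₀ 0) →
        (∀ v, v ∉ S → v ≠ w₀ → Function.Injective fun i : Fin 3 => Circle.exp (p v i)) →
        (∀ v ∈ S, p v 0 ≠ 0) →
        ∀ (n : ℕ) (m : Fin n → {w : InfinitePlace L // IsComplex w} × Fin 3),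
          HasOneSidedJump (fun ν : ℝ => bzTwistedDeriv S n (fun j => bzAdaptedVec w₀ (m j)) (stOrbFamH L νH fH S) (p + ν • nrm w₀))
            (J * bzCayScalar w₀ m * bzTwistedDeriv (insert w₀ S) n (fun j => bzCayVec (m j)) (stOrbFamH L νH fH (insert w₀ S)) (cayPt w₀ p))) :
    ∃ jcH : Finset {w : InfinitePlace L // IsComplex w} → {w : InfinitePlace L // IsComplex w} → ℂ,
      (∀ (S : Finset {w : InfinitePlace L // IsComplex w}) (w : {w : InfinitePlace L // IsComplex w}), w ∉ S → jcH S w ≠ 0) ∧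
      ∀ fH : ↥(arch (↥(maximalRealSubfield L)) L (IsCMField.complexConj L) 2 (Matrix.of fun i j : Fin 2 => if i.val + j.val + 1 = 2 then (1 : L) else 0)) ×
          ↥(arch (↥(maximalRealSubfield L)) L (IsCMField.complexConj L) 1 (Matrix.of fun i j : Fin 1 => if i.val + j.val + 1 = 1 then (1 : L) else 0)) → ℂ,
        ArchSmooth₂ L fH → ArchBzJump jcH (stOrbFamH L νH fH) := by
  obtain ⟨jcH, hne, hJ⟩ := exists_archBzJump_of_forall_gSemireg_uniform
    (A := {fH : ↥(arch (↥(maximalRealSubfield L)) L (IsCMField.complexConj L) 2 (Matrix.of fun i j : Fin 2 => if i.val + j.val + 1 = 2 then (1 : L) else 0)) ×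
          ↥(arch (↥(maximalRealSubfield L)) L (IsCMField.complexConj L) 1 (Matrix.of fun i j : Fin 1 => if i.val + j.val + 1 = 1 then (1 : L) else 0)) → ℂ //
        ArchSmooth₂ L fH})
    (fun a => stOrbFamH L νH a.1) (fun a => archBzSmoothBounded_stOrbFamH L νH a.2)
    (fun S w₀ hw₀ => by
      obtain ⟨J, hJ0, hJ⟩ := hsemi S w₀ hw₀
      exact ⟨J, hJ0, fun a => hJ a.1 a.2⟩)
  exact ⟨jcH, hne, fun fH hfH => hJ ⟨fH, hfH⟩⟩

/-- **HEAD (ii) — THE FORWARD HALF OF LETTER L3′ FOR GENERAL `fH`, WITH ONE DATUM**: under the same socket, ONE jump datum `jcH`, non-zero at every wall, with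
`ArchBouazizSpaceH jcH (stOrbFamH L νH fH)` for EVERY `fH ∈ C_c^∞(H_∞)` — the first two conjuncts of the leaf's `BouazizSurjectiveStatement` token for token ((P), (W), (I₁)+(I₂), (I₄) by ★
`archBouazizSpaceH_stOrbFamH_of_jump`). [cite: Bouaziz1994IntegralesOrbitales, §6.2 p. 591, Thm. 6.2.1 (i)] [cite: Shelstad1979, §4 pp. 22–23; Thm. 4.7 (p. 31)] -/
theorem exists_archBouazizSpaceH_stOrbFamH
    (hsemi : ∀ (S : Finset {w : InfinitePlace L // IsComplex w}) (w₀ : {w : InfinitePlace L // IsComplex w}), w₀ ∉ S → ∃ J : ℂ, J ≠ 0 ∧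
      ∀ fH : ↥(arch (↥(maximalRealSubfield L)) L (IsCMField.complexConj L) 2 (Matrix.of fun i j : Fin 2 => if i.val + j.val + 1 = 2 then (1 : L) else 0)) ×
          ↥(arch (↥(maximalRealSubfield L)) L (IsCMField.complexConj L) 1 (Matrix.of fun i j : Fin 1 => if i.val + j.val + 1 = 1 then (1 : L) else 0)) → ℂ,
        ArchSmooth₂ L fH →
        ∀ p : {w : InfinitePlace L // IsComplex w} → Fin 3 → ℝ, p w₀ 0 = p w₀ 2 →
        Circle.exp (p w₀ 1) ≠ Circle.exp (p w₀ 0) →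
        (∀ v, v ∉ S → v ≠ w₀ → Function.Injective fun i : Fin 3 => Circle.exp (p v i)) →
        (∀ v ∈ S, p v 0 ≠ 0) →
        ∀ (n : ℕ) (m : Fin n → {w : InfinitePlace L // IsComplex w} × Fin 3),
          HasOneSidedJump (fun ν : ℝ => bzTwistedDeriv S n (fun j => bzAdaptedVec w₀ (m j)) (stOrbFamH L νH fH S) (p + ν • nrm w₀))
            (J * bzCayScalar w₀ m * bzTwistedDeriv (insert w₀ S) n (fun j => bzCayVec (m j)) (stOrbFamH L νH fH (insert w₀ S)) (cayPt w₀ p))) :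
    ∃ jcH : Finset {w : InfinitePlace L // IsComplex w} → {w : InfinitePlace L // IsComplex w} → ℂ,
      (∀ (S : Finset {w : InfinitePlace L // IsComplex w}) (w : {w : InfinitePlace L // IsComplex w}), w ∉ S → jcH S w ≠ 0) ∧
      ∀ fH : ↥(arch (↥(maximalRealSubfield L)) L (IsCMField.complexConj L) 2 (Matrix.of fun i j : Fin 2 => if i.val + j.val + 1 = 2 then (1 : L) else 0)) ×
          ↥(arch (↥(maximalRealSubfield L)) L (IsCMField.complexConj L) 1 (Matrix.of fun i j : Fin 1 => if i.val + j.val + 1 = 1 then (1 : L) else 0)) → ℂ,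
        ArchSmooth₂ L fH → ArchBouazizSpaceH jcH (stOrbFamH L νH fH) := by
  obtain ⟨jcH, hne, hJ⟩ := exists_archBzJump_stOrbFamH L νH hsemi
  exact ⟨jcH, hne, fun fH hfH => archBouazizSpaceH_stOrbFamH_of_jump L νH jcH hfH (hJ fH hfH)⟩

end StOrbFamH

/-! ## §3 The heads in the LEAF frame: ONE Borel σ-algebra on the product `H_∞ = U(Φ₂)_∞ × U(Φ₁)_∞` (the binder of `BouazizSurjectiveStatement`) -/

section LeafFrame

variable (L : Type) [Field L] [NumberField L] [IsCMField L]
  [MeasurableSpace (↥(arch (↥(maximalRealSubfield L)) L (IsCMField.complexConj L) 2 (Matrix.of fun i j : Fin 2 => if i.val + j.val + 1 = 2 then (1 : L) else 0)) ×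
      ↥(arch (↥(maximalRealSubfield L)) L (IsCMField.complexConj L) 1 (Matrix.of fun i j : Fin 1 => if i.val + j.val + 1 = 1 then (1 : L) else 0)))]
  [BorelSpace (↥(arch (↥(maximalRealSubfield L)) L (IsCMField.complexConj L) 2 (Matrix.of fun i j : Fin 2 => if i.val + j.val + 1 = 2 then (1 : L) else 0)) ×
      ↥(arch (↥(maximalRealSubfield L)) L (IsCMField.complexConj L) 1 (Matrix.of fun i j : Fin 1 => if i.val + j.val + 1 = 1 then (1 : L) else 0)))]
  (νH : Measure (↥(arch (↥(maximalRealSubfield L)) L (IsCMField.complexConj L) 2 (Matrix.of fun i j : Fin 2 => if i.val + j.val + 1 = 2 then (1 : L) else 0)) ×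
      ↥(arch (↥(maximalRealSubfield L)) L (IsCMField.complexConj L) 1 (Matrix.of fun i j : Fin 1 => if i.val + j.val + 1 = 1 then (1 : L) else 0))))
  [νH.IsHaarMeasure] [νH.IsMulRightInvariant]

/-- **(I₁)+(I₂) IN THE LEAF FRAME**: ★ `archBzSmoothBounded_stOrbFamH` read with ONE Borel σ-algebra on the product `H_∞` (the frame of the leaf's `BouazizSurjectiveStatement`) instead of the
product of the Borel σ-algebras of the factors and Borel σ-algebras at the places — the two coincide (`Prod.borelSpace`, second countability ★ `instSecondCountableTopologyArch`), and the
per-place σ-algebras are chosen Borel inside. [cite: Bouaziz1994IntegralesOrbitales, §3.1 (I₁)(I₂) p. 579; §6.2 p. 591] [cite: Shelstad1979, §4 pp. 22–25] -/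
theorem archBzSmoothBounded_stOrbFamH_borel
    {fH : ↥(arch (↥(maximalRealSubfield L)) L (IsCMField.complexConj L) 2 (Matrix.of fun i j : Fin 2 => if i.val + j.val + 1 = 2 then (1 : L) else 0)) ×
      ↥(arch (↥(maximalRealSubfield L)) L (IsCMField.complexConj L) 1 (Matrix.of fun i j : Fin 1 => if i.val + j.val + 1 = 1 then (1 : L) else 0)) → ℂ}
    (hfH : ArchSmooth₂ L fH) : ArchBzSmoothBounded (stOrbFamH L νH fH) := by
  letI mA : MeasurableSpace ↥(arch (↥(maximalRealSubfield L)) L (IsCMField.complexConj L) 2 (Matrix.of fun i j : Fin 2 => if i.val + j.val + 1 = 2 then (1 : L) else 0)) :=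
    borel _
  haveI : BorelSpace ↥(arch (↥(maximalRealSubfield L)) L (IsCMField.complexConj L) 2 (Matrix.of fun i j : Fin 2 => if i.val + j.val + 1 = 2 then (1 : L) else 0)) := ⟨rfl⟩
  letI mB : MeasurableSpace ↥(arch (↥(maximalRealSubfield L)) L (IsCMField.complexConj L) 1 (Matrix.of fun i j : Fin 1 => if i.val + j.val + 1 = 1 then (1 : L) else 0)) :=
    borel _
  haveI : BorelSpace ↥(arch (↥(maximalRealSubfield L)) L (IsCMField.complexConj L) 1 (Matrix.of fun i j : Fin 1 => if i.val + j.val + 1 = 1 then (1 : L) else 0)) := ⟨rfl⟩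
  letI : ∀ w : {w : InfinitePlace L // IsComplex w},
      MeasurableSpace ↥(archLocal L 2 (Matrix.of fun i j : Fin 2 => if i.val + j.val + 1 = 2 then (1 : L) else 0) w) := fun _ => borel _
  haveI : ∀ w : {w : InfinitePlace L // IsComplex w},
      BorelSpace ↥(archLocal L 2 (Matrix.of fun i j : Fin 2 => if i.val + j.val + 1 = 2 then (1 : L) else 0) w) := fun _ => ⟨rfl⟩
  have hmm : ‹MeasurableSpace (↥(arch (↥(maximalRealSubfield L)) L (IsCMField.complexConj L) 2 (Matrix.of fun i j : Fin 2 => if i.val + j.val + 1 = 2 then (1 : L) else 0)) ×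
      ↥(arch (↥(maximalRealSubfield L)) L (IsCMField.complexConj L) 1 (Matrix.of fun i j : Fin 1 => if i.val + j.val + 1 = 1 then (1 : L) else 0)))› =
      Prod.instMeasurableSpace := by
    rw [BorelSpace.measurable_eq (α := ↥(arch (↥(maximalRealSubfield L)) L (IsCMField.complexConj L) 2 (Matrix.of fun i j : Fin 2 => if i.val + j.val + 1 = 2 then (1 : L) else 0)) ×
      ↥(arch (↥(maximalRealSubfield L)) L (IsCMField.complexConj L) 1 (Matrix.of fun i j : Fin 1 => if i.val + j.val + 1 = 1 then (1 : L) else 0)))]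
    exact (Prod.borelSpace.measurable_eq).symm
  subst hmm
  exact archBzSmoothBounded_stOrbFamH L νH hfH

/-- **HEAD (ii) IN THE LEAF FRAME — THE FORWARD HALF OF LETTER L3′**: under the socket `hsemi` (the constant BEFORE the test function), ONE jump datum `jcH`, non-zero at every wall, with
`ArchBouazizSpaceH jcH (stOrbFamH L νH fH)` for EVERY `fH ∈ C_c^∞(H_∞)`, in the frame `[MeasurableSpace H_∞] [BorelSpace H_∞] (νH : Measure H_∞) [IsHaarMeasure] [IsMulRightInvariant]` of the leaf's
`BouazizSurjectiveStatement` (its conjuncts 1–2 token for token). [cite: Bouaziz1994IntegralesOrbitales, §6.2 p. 591, Thm. 6.2.1 (i)] [cite: Shelstad1979, §4 pp. 22–23; Thm. 4.7 (p. 31)] -/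
theorem exists_archBouazizSpaceH_stOrbFamH_borel
    (hsemi : ∀ (S : Finset {w : InfinitePlace L // IsComplex w}) (w₀ : {w : InfinitePlace L // IsComplex w}), w₀ ∉ S → ∃ J : ℂ, J ≠ 0 ∧
      ∀ fH : ↥(arch (↥(maximalRealSubfield L)) L (IsCMField.complexConj L) 2 (Matrix.of fun i j : Fin 2 => if i.val + j.val + 1 = 2 then (1 : L) else 0)) ×
          ↥(arch (↥(maximalRealSubfield L)) L (IsCMField.complexConj L) 1 (Matrix.of fun i j : Fin 1 => if i.val + j.val + 1 = 1 then (1 : L) else 0)) → ℂ,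
        ArchSmooth₂ L fH →
        ∀ p : {w : InfinitePlace L // IsComplex w} → Fin 3 → ℝ, p w₀ 0 = p w₀ 2 →
        Circle.exp (p w₀ 1) ≠ Circle.exp (p w₀ 0) →
        (∀ v, v ∉ S → v ≠ w₀ → Function.Injective fun i : Fin 3 => Circle.exp (p v i)) →
        (∀ v ∈ S, p v 0 ≠ 0) →
        ∀ (n : ℕ) (m : Fin n → {w : InfinitePlace L // IsComplex w} × Fin 3),
          HasOneSidedJump (fun ν : ℝ => bzTwistedDeriv S n (fun j => bzAdaptedVec w₀ (m j)) (stOrbFamH L νH fH S) (p + ν • nrm w₀))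
            (J * bzCayScalar w₀ m * bzTwistedDeriv (insert w₀ S) n (fun j => bzCayVec (m j)) (stOrbFamH L νH fH (insert w₀ S)) (cayPt w₀ p))) :
    ∃ jcH : Finset {w : InfinitePlace L // IsComplex w} → {w : InfinitePlace L // IsComplex w} → ℂ,
      (∀ (S : Finset {w : InfinitePlace L // IsComplex w}) (w : {w : InfinitePlace L // IsComplex w}), w ∉ S → jcH S w ≠ 0) ∧
      ∀ fH : ↥(arch (↥(maximalRealSubfield L)) L (IsCMField.complexConj L) 2 (Matrix.of fun i j : Fin 2 => if i.val + j.val + 1 = 2 then (1 : L) else 0)) ×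
          ↥(arch (↥(maximalRealSubfield L)) L (IsCMField.complexConj L) 1 (Matrix.of fun i j : Fin 1 => if i.val + j.val + 1 = 1 then (1 : L) else 0)) → ℂ,
        ArchSmooth₂ L fH → ArchBouazizSpaceH jcH (stOrbFamH L νH fH) := by
  obtain ⟨jcH, hne, hJ⟩ := exists_archBzJump_of_forall_gSemireg_uniform
    (A := {fH : ↥(arch (↥(maximalRealSubfield L)) L (IsCMField.complexConj L) 2 (Matrix.of fun i j : Fin 2 => if i.val + j.val + 1 = 2 then (1 : L) else 0)) ×
          ↥(arch (↥(maximalRealSubfield L)) L (IsCMField.complexConj L) 1 (Matrix.of fun i j : Fin 1 => if i.val + j.val + 1 = 1 then (1 : L) else 0)) → ℂ //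
        ArchSmooth₂ L fH})
    (fun a => stOrbFamH L νH a.1) (fun a => archBzSmoothBounded_stOrbFamH_borel L νH a.2)
    (fun S w₀ hw₀ => by
      obtain ⟨J, hJ0, hJ⟩ := hsemi S w₀ hw₀
      exact ⟨J, hJ0, fun a => hJ a.1 a.2⟩)
  exact ⟨jcH, hne, fun fH hfH => archBouazizSpaceH_stOrbFamH_of_smoothBounded_of_jump L νH jcH fH (ArchSmooth₂.hasCompactSupport L hfH)
    (archBzSmoothBounded_stOrbFamH_borel L νH hfH) (hJ ⟨fH, hfH⟩)⟩

end LeafFrame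

end Literature.NumberTheory.Rogawski1990

end
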